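import Summits.HodgeConjecture.HodgeConjecture.Theorems.MotivatedLefschetzSplitLefschetzStandardBLowerHalf
import Summits.HodgeConjecture.HodgeConjecture.Theorems.MotivatedLefschetzSplitLefschetzStandardBCayleyHamiltonTransfer
import Summits.HodgeConjecture.HodgeConjecture.Theorems.MotivatedLefschetzSplitLefschetzStandardBCharlesSpread
import Summits.HodgeConjecture.HodgeConjecture.Theses.MotivatedLefschetzSplit
import HarnessLib

/-!
# Crux `LefschetzStandardB` (stmt-HodgeConjecture-17489) REDUCED TO ITS FAMILY SUPPLY:
# `B(X)` for every smooth projective complex `X` ⟸ "every `Hᵇ(Z)`, `b < dim Z`, is swept out by a family of algebraic cycles"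

Route `HodgeConjecture/MotivatedLefschetzSplit`, crux #3 `LefschetzStandardB` (Grothendieck's standard conjecture of Lefschetz
type, André's `*_L`-form, for EVERY smooth projective complex variety); registered skeleton `Cruxes/LefschetzStandardB/Lines/birth.lean`
with composition `LefschetzStandardB_of : Sig.stub_lowerHalf → Sig.stub_familySupply → Sig.stub_charlesSpread →
Sig.stub_cayleyHamiltonTransfer → LefschetzStandardB`. Three of the four stubs are now theorems of the tree
(`stub_lowerHalf`, `stub_charlesSpread`, `stub_cayleyHamiltonTransfer` in `Theorems/MotivatedLefschetzSplitLefschetzStandardB*.lean`);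
this file runs the skeleton's composition with them, so that the crux is, in the kernel, EQUIVALENT-UP-TO its single open stub:

* **`lefschetzStandardB_of_familySupply`** — `LefschetzStandardB` (by name) follows from the FAMILY SUPPLY alone: for every smooth
  projective `Z` of dimension `d` and all `a + b = 2d`, `d < a`, some smooth projective `S` of dimension `l ≥ b` carries a
  SURJECTIVE algebraic correspondence `H^{2l-b}(S(ℂ); ℂ) → Hᵇ(Z(ℂ); ℂ)` (Charles 2013, Prop. 8, right-hand side; for `b = 2` his
  Thm. 1). The proof is the skeleton's strong induction on the target degree `b` (Charles's spread needs `B` below `b` for all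
  varieties: the lower half or the induction hypothesis).
* **`isAlgebraicCorrespondence_lefschetzInvolution_of_familySupply_of_le_three`** — the first two stages need no induction
  hypothesis: for ANY smooth projective `Z` and a target degree `b ≤ 3`, a family supply for `(Z, b)` alone makes the inverse
  Lefschetz isomorphism `*_L : H^{2d-b}(Z(ℂ); ℂ) → Hᵇ(Z(ℂ); ℂ)` an algebraic correspondence (conjecture `B` in target degrees
  `≤ 1` being a theorem of the tree); whence **`B` for THREEFOLDS and FOURFOLDS from family supplies in degrees `2` and `3`
  only** (`standardConjectureBStar_threefold_of_familySupply`, `standardConjectureBStar_fourfold_of_familySupply`).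

Nothing here is a case of the Hodge conjecture; `B(X)` is not asserted — every statement carries its family supply as a
hypothesis; no definition, no named fact, no sorry. References: [Charles2013] Lemma 6, Lemma 7, Prop. 8, Thm. 1
(arXiv:1002.5011); [Kleiman1968AlgebraicCycles] §2, App. Thm. 2A11; [Andre1996Motifs] §0.2–0.3, §1.1, §3.2 Remarque;
[Grothendieck1968] §3 p. 196; [Voisin2025] §3.2.2 Conj. 3.11.
-/

noncomputable section

-- every declaration of this problem lives in `Summit.HodgeConjecture.HodgeConjecture.…` (summit = sub-problem)
set_option linter.dupNamespace false

open CategoryTheory AlgebraicGeometry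
open Literature.AlgebraicGeometry.Motives Literature.AlgebraicGeometry.HodgeTheory

namespace Summit.HodgeConjecture.HodgeConjecture.Theorems.LefschetzStandardB

/-- **`*_L : H^{2d-b}(Z) → Hᵇ(Z)` is algebraic for `b ≤ 3` as soon as `Hᵇ(Z)` has a family supply** — for EVERY smooth
projective complex `Z` of dimension `d > b`: Charles's spread (`stub_charlesSpread`) fed with the tree's unconditional degrees
(`charlesSpread_hypothesis_of_le_three`: the lower half and the target degrees `≤ 1`), then Kleiman's Cayley–Hamilton transfer
(`stub_cayleyHamiltonTransfer`). [cite: Charles2013, Prop. 8 and Lemma 6 (arXiv:1002.5011)] [cite: Kleiman1968AlgebraicCycles, Appendix Thm. 2A11] -/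
theorem isAlgebraicCorrespondence_lefschetzInvolution_of_familySupply_of_le_three {d : ℕ} {Z : SchemeOver ℂ}
    (hZ : IsSmoothProjective d Z) {η : complexBetti Z 2} (hη : IsPolarizationClass d Z η) {a b : ℕ}
    (hab : a + b = 2 * d) (hda : d < a) (hb : b ≤ 3)
    (hsupply : ∃ (l : ℕ) (S : SchemeOver ℂ) (_ : IsSmoothProjective l S) (a' : ℕ) (_ : a' + b = 2 * l)
      (_ : b ≤ l) (T : complexBetti S a' →ₗ[ℂ] complexBetti Z b),
      Function.Surjective T ∧ IsAlgebraicCorrespondence d l Z S T) :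
    IsAlgebraicCorrespondence d d Z Z (lefschetzInvolution hη.hasHardLefschetz hab) :=
  stub_cayleyHamiltonTransfer d Z η hZ hη a b hab (by omega)
    (stub_lowerHalf d Z η hZ hη b a (by omega) (by omega))
    (stub_charlesSpread d Z hZ a b hab hda (charlesSpread_hypothesis_of_le_three hb) hsupply)

/-- **The crux `LefschetzStandardB` from the family supply alone** (the skeleton's composition `LefschetzStandardB_of` run with the
three landed stubs): if for every smooth projective `Z` of dimension `d` and all degrees `a + b = 2d`, `d < a`, the cohomology
`Hᵇ(Z(ℂ); ℂ)` is the image of a SURJECTIVE algebraic correspondence from some `H^{2l-b}(S(ℂ); ℂ)`, `S` smooth projective of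
dimension `l ≥ b`, then Grothendieck's `B(Z)` holds (André's `*_L`-form) for every smooth projective complex `Z` and every
polarisation class. Strong induction on the target degree `b`: at stage `b`, Charles's spread consumes `B` below `b` for all
varieties — the lower half (`stub_lowerHalf`) or the induction hypothesis — and the supply, and Kleiman's transfer concludes.
[cite: Charles2013, Prop. 8 with Lemma 6 and Lemma 7 (arXiv:1002.5011)] [cite: Kleiman1968AlgebraicCycles, §2 and Appendix Thm. 2A11]
[cite: Grothendieck1968, §3 p. 196 (B(X))] -/
theorem lefschetzStandardB_of_familySupply
    (hsupply : ∀ (d : ℕ) (Z : SchemeOver ℂ), IsSmoothProjective d Z →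
      ∀ (a b : ℕ), a + b = 2 * d → d < a →
        ∃ (l : ℕ) (S : SchemeOver ℂ) (_ : IsSmoothProjective l S) (a' : ℕ) (_ : a' + b = 2 * l)
          (_ : b ≤ l) (T : complexBetti S a' →ₗ[ℂ] complexBetti Z b),
          Function.Surjective T ∧ IsAlgebraicCorrespondence d l Z S T) :
    Summit.HodgeConjecture.HodgeConjecture.Theses.MotivatedLefschetzSplit.LefschetzStandardB := by
  -- the upper half `d < a`, by strong induction on the target degree `b`
  have upper : ∀ (b d : ℕ) (Z : SchemeOver ℂ) (η : complexBetti Z 2), IsSmoothProjective d Z →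
      ∀ (hη : IsPolarizationClass d Z η) (a : ℕ) (hab : a + b = 2 * d), d < a →
        IsAlgebraicCorrespondence d d Z Z (lefschetzInvolution hη.hasHardLefschetz hab) := by
    intro b
    induction b using Nat.strong_induction_on with
    | _ b ih =>
      intro d Z η hZ hη a hab hda
      refine stub_cayleyHamiltonTransfer d Z η hZ hη a b hab (by omega)
        (stub_lowerHalf d Z η hZ hη b a (by omega) (by omega)) ?_
      refine stub_charlesSpread d Z hZ a b hab hda ?_ (hsupply d Z hZ a b hab hda)
      intro l S κ hS hκ a' b' hab' h
      rcases Nat.lt_or_ge l a' with h' | h'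
      · have hb' : b' + 2 ≤ b := h.resolve_left (by omega)
        exact ih b' (by omega) l S κ hS hκ a' hab' h'
      · exact stub_lowerHalf l S κ hS hκ a' b' hab' h'
  intro d Z η hZ hη a b hab
  rcases Nat.lt_or_ge d a with ha | ha
  · exact upper b d Z η hZ hη a hab ha
  · exact stub_lowerHalf d Z η hZ hη a b hab ha

/-- **`B` for a smooth projective complex THREEFOLD from a family supply for its `H²` alone**: the degrees `a ≤ 3` are the lower
half, `a = 4` (`b = 2`) is the supplied one (`isAlgebraicCorrespondence_lefschetzInvolution_of_familySupply_of_le_three`),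
`a = 5, 6` (`b = 1, 0`) are unconditional (Lefschetz `(1,1)` on `Z × Z`; top degree). Charles 2013 Thm. 1 describes the supply:
a family `(Γ_s)_{s ∈ S}` of curves with `Λ² T_{S,s} ↠ H²(Z, 𝒪_Z)`. [cite: Charles2013, Thm. 1 and Prop. 8 (arXiv:1002.5011)]
[cite: Voisin2025, §3.2.2 Conj. 3.11] -/
theorem standardConjectureBStar_threefold_of_familySupply {Z : SchemeOver ℂ} (hZ : IsSmoothProjective 3 Z)
    (hsupply : ∃ (l : ℕ) (S : SchemeOver ℂ) (_ : IsSmoothProjective l S) (a' : ℕ) (_ : a' + 2 = 2 * l)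
      (_ : 2 ≤ l) (T : complexBetti S a' →ₗ[ℂ] complexBetti Z 2),
      Function.Surjective T ∧ IsAlgebraicCorrespondence 3 l Z S T)
    (η : complexBetti Z 2) : StandardConjectureBStar 3 Z η := by
  intro hη a b hab
  rcases Nat.lt_or_ge 3 a with ha | ha
  · rcases Nat.lt_or_ge b 2 with hb | hb
    · exact lefschetzInvolution_algebraic_of_le_or_le_one hZ hη a b hab (Or.inr (by omega))
    · obtain rfl : b = 2 := by omega
      exact isAlgebraicCorrespondence_lefschetzInvolution_of_familySupply_of_le_three hZ hη hab ha (by omega) hsupply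
  · exact stub_lowerHalf 3 Z η hZ hη a b hab ha

/-- **`B` for a smooth projective complex FOURFOLD from family supplies for its `H²` and `H³`** (degrees `a ≤ 4` lower half,
`a = 5, 6` supplied with `b = 3, 2 ≤ 3`, `a = 7, 8` unconditional). [cite: Charles2013, Prop. 8 (arXiv:1002.5011)]
[cite: Voisin2025, §3.2.2 Conj. 3.11] -/
theorem standardConjectureBStar_fourfold_of_familySupply {Z : SchemeOver ℂ} (hZ : IsSmoothProjective 4 Z)
    (hsupply : ∀ b, 2 ≤ b → b ≤ 3 → ∃ (l : ℕ) (S : SchemeOver ℂ) (_ : IsSmoothProjective l S) (a' : ℕ)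
      (_ : a' + b = 2 * l) (_ : b ≤ l) (T : complexBetti S a' →ₗ[ℂ] complexBetti Z b),
      Function.Surjective T ∧ IsAlgebraicCorrespondence 4 l Z S T)
    (η : complexBetti Z 2) : StandardConjectureBStar 4 Z η := by
  intro hη a b hab
  rcases Nat.lt_or_ge 4 a with ha | ha
  · rcases Nat.lt_or_ge b 2 with hb | hb
    · exact lefschetzInvolution_algebraic_of_le_or_le_one hZ hη a b hab (Or.inr (by omega))
    · exact isAlgebraicCorrespondence_lefschetzInvolution_of_familySupply_of_le_three hZ hη hab ha (by omega)
        (hsupply b hb (by omega))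
  · exact stub_lowerHalf 4 Z η hZ hη a b hab ha

end Summit.HodgeConjecture.HodgeConjecture.Theorems.LefschetzStandardB

end
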